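import Summits.BirchSwinnertonDyer.BirchSwinnertonDyer.Theorems.ResidualThetaTransportAtTwoSignedMuVanishingAtTwoPlusMultOneOldFamilyEngine
import HarnessLib

/-!
# Route `ResidualThetaTransportAtTwo`, crux Kμ⁺ `SignedMuVanishingAtTwoPlus` (stmt-BirchSwinnertonDyer-20689), line
# `birth`, stub `stub_flatMuZeroAtTwo`: FIBER IDENTITIES for old sums — `T_p` on `Σ_{t∈S₀} (D_t + D_{tq})`,
# `Σ (D_t + D_{tℓ} + D_{tℓ²})`, … over an arbitrary index set `S₀ ⊂ ℕ⁺`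

Cell `bsd-wall`, width seat `bsd-wall-rtt-p4-w2` (g4). THEOREMS ONLY; helper `--supports` the crux; closes nothing. BSD is not proved
by this. Companion of `…MultOneOldFamilyGeneric` (`flatAtTwo_of_namedFacts_of_oldSum`): that theorem asks, for each prime `p ∣ N_W`,
for an identity `T_p H_S = A_p • H_S + 2 • K_p`; the identities below compute `T_p H_S` fibre-by-fibre for the four local
situations met on the habitat⁺ (`q ∥ N_W` level-raising, `ℓ ∣ N₀` with `ℓ² ∣ N_W`, `ℓ ∤ N₀` with `ℓ² ∥ N_W` in two or three
layers, `p ∣ N₀` inert), so that a multi-prime level pattern is assembled by finitely many rewrites.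

## What is proved
* `oldSum_union_map`: `Σ_{t ∈ S₀ ∪ S₀·q} D_t = Σ_{t∈S₀} D_t + Σ_{t∈S₀} D_{tq}` (disjoint union).
* `heckeT_fiber_levelRaising` (`q ∤ N₀`, `q ∣ N`): `T_q (Σ D_t + Σ D_{tq}) = (a_q(g) + q) • Σ D_t − Σ D_{tq}`.
* `heckeT_fiber_of_dvd_level` (`ℓ ∣ N₀`): `T_ℓ (Σ D_t + Σ D_{tℓ}) = (a_ℓ(g) + ℓ) • Σ D_t`.
* `heckeT_fiber_sq_two` / `heckeT_fiber_sq_three` (`ℓ ∤ N₀`, `ℓ² ∣ N`): `T_ℓ (Σ D_t + Σ D_{tℓ²}) = a_ℓ • Σ D_t + (ℓ−1) • Σ D_{tℓ}`,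
  `T_ℓ (Σ D_t + Σ D_{tℓ} + Σ D_{tℓ²}) = (a_ℓ + ℓ) • Σ D_t + (ℓ−1) • Σ D_{tℓ}`.
* `heckeT_oldSum_of_dvd_level_of_coprime` (`p ∣ N₀`, `p ∤ t` on `S`): `T_p H_S = a_p(g) • H_S`.

References: [AtkinLehner1970] Lemma 15; [DiamondShurman2005] Prop. 5.2.2 (a), §5.7, Prop. 5.8.5.
-/

set_option autoImplicit false
set_option linter.dupNamespace false

noncomputable section

open scoped Classical MatrixGroups ModularForm

open CongruenceSubgroup Field WeierstrassCurve Literature.NumberTheory.EllipticCurves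
  Literature.NumberTheory.EllipticCurves.ModularForms Literature.NumberTheory.EllipticCurves.Rank1Residual
  Literature.NumberTheory.IwasawaTheory Summit.BirchSwinnertonDyer.Rank1Residual.Supersingular
  Summit.BirchSwinnertonDyer.BirchSwinnertonDyer.Theses.ResidualThetaTransportAtTwo

namespace Summit.BirchSwinnertonDyer.BirchSwinnertonDyer.Theorems.SignedMuAtTwo

namespace MultOneDictionary

section Fibers

variable {N₀ N : ℕ} [NeZero N₀] [NeZero N] (g : CuspForm (Gamma0 N₀) 2)

/-- **Splitting an old sum along a fibration** `S = S₀ ⊔ S₀·q`. [folklore] -/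
theorem oldSum_union_map (S₀ : Finset ℕ+) (q : ℕ+) (hdisj : Disjoint S₀ (S₀.map (mulRightEmbedding q))) :
    ∑ t ∈ S₀ ∪ S₀.map (mulRightEmbedding q), degeneracyMap0 N₀ N (t : ℕ) 2 g =
      ∑ t ∈ S₀, degeneracyMap0 N₀ N (t : ℕ) 2 g + ∑ t ∈ S₀, degeneracyMap0 N₀ N ((t * q : ℕ+) : ℕ) 2 g := by
  rw [Finset.sum_union hdisj, Finset.sum_map]
  rfl

variable {g} (hg : IsNewform0 g)

include hg in
/-- **Level-raising fibre** (`q ∤ N₀`, `q ∣ N`): `T_q (Σ_{t∈S₀} D_t + Σ_{t∈S₀} D_{tq}) = (a_q(g) + q) • Σ D_t − Σ D_{tq}` for `q ∤ t`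
on `S₀`. [cite: DiamondShurman2005, Prop. 5.2.2 (a), §5.7, Prop. 5.8.5] -/
theorem heckeT_fiber_levelRaising (q : ℕ+) (hq : (q : ℕ).Prime) (hqN : (q : ℕ) ∣ N) (hqN₀ : ¬ (q : ℕ) ∣ N₀)
    (S₀ : Finset ℕ+) (hS₀ : ∀ t ∈ S₀, ¬ (q : ℕ) ∣ (t : ℕ)) (h : ∀ t ∈ S₀, N₀ * (t : ℕ) ∣ N)
    (h' : ∀ t ∈ S₀, N₀ * ((t * q : ℕ+) : ℕ) ∣ N) :
    heckeT (Gamma0 N) 2 q (∑ t ∈ S₀, degeneracyMap0 N₀ N (t : ℕ) 2 g + ∑ t ∈ S₀, degeneracyMap0 N₀ N ((t * q : ℕ+) : ℕ) 2 g) =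
      (cuspCoeff g q + q) • ∑ t ∈ S₀, degeneracyMap0 N₀ N (t : ℕ) 2 g -
        ∑ t ∈ S₀, degeneracyMap0 N₀ N ((t * q : ℕ+) : ℕ) 2 g := by
  have h1 : ∀ t ∈ S₀, heckeT (Gamma0 N) 2 q (degeneracyMap0 N₀ N (t : ℕ) 2 g) =
      cuspCoeff g q • degeneracyMap0 N₀ N (t : ℕ) 2 g - degeneracyMap0 N₀ N ((t * q : ℕ+) : ℕ) 2 g := fun t ht ↦
    heckeT_D_of_not_dvd (N := N) hg hq hqN hqN₀ (hS₀ t ht) (PNat.mul_coe t q) (h t ht) (h' t ht)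
  have h2 : ∀ t ∈ S₀, heckeT (Gamma0 N) 2 q (degeneracyMap0 N₀ N ((t * q : ℕ+) : ℕ) 2 g) =
      ((q : ℕ) : ℂ) • degeneracyMap0 N₀ N (t : ℕ) 2 g := fun t ht ↦
    heckeT_D_of_dvd (N := N) g hq hqN (PNat.mul_coe t q) (h t ht) (h' t ht)
  rw [map_add, map_sum, map_sum, Finset.sum_congr rfl h1, Finset.sum_congr rfl h2, Finset.sum_sub_distrib,
    ← Finset.smul_sum, ← Finset.smul_sum, add_smul]
  abel

include hg in
/-- **Fibre at a prime of the anchor's level** (`ℓ ∣ N₀`, `ℓ ∣ N/N₀·t`): `T_ℓ (Σ D_t + Σ D_{tℓ}) = (a_ℓ(g) + ℓ) • Σ D_t` for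
`ℓ ∤ t` on `S₀`. [cite: DiamondShurman2005, Prop. 5.2.2 (a), §5.7] -/
theorem heckeT_fiber_of_dvd_level (ℓ : ℕ+) (hℓ : (ℓ : ℕ).Prime) (hℓN : (ℓ : ℕ) ∣ N) (hℓN₀ : (ℓ : ℕ) ∣ N₀)
    (S₀ : Finset ℕ+) (hS₀ : ∀ t ∈ S₀, ¬ (ℓ : ℕ) ∣ (t : ℕ)) (h : ∀ t ∈ S₀, N₀ * (t : ℕ) ∣ N)
    (h' : ∀ t ∈ S₀, N₀ * ((t * ℓ : ℕ+) : ℕ) ∣ N) :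
    heckeT (Gamma0 N) 2 ℓ (∑ t ∈ S₀, degeneracyMap0 N₀ N (t : ℕ) 2 g + ∑ t ∈ S₀, degeneracyMap0 N₀ N ((t * ℓ : ℕ+) : ℕ) 2 g) =
      (cuspCoeff g ℓ + ℓ) • ∑ t ∈ S₀, degeneracyMap0 N₀ N (t : ℕ) 2 g := by
  have h1 : ∀ t ∈ S₀, heckeT (Gamma0 N) 2 ℓ (degeneracyMap0 N₀ N (t : ℕ) 2 g) =
      cuspCoeff g ℓ • degeneracyMap0 N₀ N (t : ℕ) 2 g := fun t ht ↦
    heckeT_D_of_dvd_level (N := N) hg hℓ hℓN₀ (hS₀ t ht) (h t ht)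
  have h2 : ∀ t ∈ S₀, heckeT (Gamma0 N) 2 ℓ (degeneracyMap0 N₀ N ((t * ℓ : ℕ+) : ℕ) 2 g) =
      ((ℓ : ℕ) : ℂ) • degeneracyMap0 N₀ N (t : ℕ) 2 g := fun t ht ↦
    heckeT_D_of_dvd (N := N) g hℓ hℓN (PNat.mul_coe t ℓ) (h t ht) (h' t ht)
  rw [map_add, map_sum, map_sum, Finset.sum_congr rfl h1, Finset.sum_congr rfl h2, ← Finset.smul_sum, ← Finset.smul_sum,
    add_smul]

include hg in
/-- **Square fibre, two layers** (`ℓ ∤ N₀`, `ℓ² t N₀ ∣ N`): `T_ℓ (Σ D_t + Σ D_{tℓ²}) = a_ℓ(g) • Σ D_t + (ℓ − 1) • Σ D_{tℓ}` for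
`ℓ ∤ t` on `S₀`. [cite: DiamondShurman2005, Prop. 5.2.2 (a), §5.7, Prop. 5.8.5] -/
theorem heckeT_fiber_sq_two (ℓ : ℕ+) (hℓ : (ℓ : ℕ).Prime) (hℓN : (ℓ : ℕ) ∣ N) (hℓN₀ : ¬ (ℓ : ℕ) ∣ N₀)
    (S₀ : Finset ℕ+) (hS₀ : ∀ t ∈ S₀, ¬ (ℓ : ℕ) ∣ (t : ℕ)) (h : ∀ t ∈ S₀, N₀ * (t : ℕ) ∣ N)
    (h' : ∀ t ∈ S₀, N₀ * ((t * ℓ : ℕ+) : ℕ) ∣ N) (h'' : ∀ t ∈ S₀, N₀ * ((t * ℓ * ℓ : ℕ+) : ℕ) ∣ N) :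
    heckeT (Gamma0 N) 2 ℓ (∑ t ∈ S₀, degeneracyMap0 N₀ N (t : ℕ) 2 g +
        ∑ t ∈ S₀, degeneracyMap0 N₀ N ((t * ℓ * ℓ : ℕ+) : ℕ) 2 g) =
      cuspCoeff g ℓ • ∑ t ∈ S₀, degeneracyMap0 N₀ N (t : ℕ) 2 g +
        (((ℓ : ℕ) : ℂ) - 1) • ∑ t ∈ S₀, degeneracyMap0 N₀ N ((t * ℓ : ℕ+) : ℕ) 2 g := by
  have h1 : ∀ t ∈ S₀, heckeT (Gamma0 N) 2 ℓ (degeneracyMap0 N₀ N (t : ℕ) 2 g) =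
      cuspCoeff g ℓ • degeneracyMap0 N₀ N (t : ℕ) 2 g - degeneracyMap0 N₀ N ((t * ℓ : ℕ+) : ℕ) 2 g := fun t ht ↦
    heckeT_D_of_not_dvd (N := N) hg hℓ hℓN hℓN₀ (hS₀ t ht) (PNat.mul_coe t ℓ) (h t ht) (h' t ht)
  have h2 : ∀ t ∈ S₀, heckeT (Gamma0 N) 2 ℓ (degeneracyMap0 N₀ N ((t * ℓ * ℓ : ℕ+) : ℕ) 2 g) =
      ((ℓ : ℕ) : ℂ) • degeneracyMap0 N₀ N ((t * ℓ : ℕ+) : ℕ) 2 g := fun t ht ↦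
    heckeT_D_of_dvd (N := N) g hℓ hℓN (PNat.mul_coe (t * ℓ) ℓ) (h' t ht) (h'' t ht)
  rw [map_add, map_sum, map_sum, Finset.sum_congr rfl h1, Finset.sum_congr rfl h2, Finset.sum_sub_distrib,
    ← Finset.smul_sum, ← Finset.smul_sum, sub_smul, one_smul]
  abel

include hg in
/-- **Square fibre, three layers** (`ℓ ∤ N₀`, `ℓ² t N₀ ∣ N`): `T_ℓ (Σ D_t + Σ D_{tℓ} + Σ D_{tℓ²}) = (a_ℓ(g) + ℓ) • Σ D_t +
(ℓ − 1) • Σ D_{tℓ}` for `ℓ ∤ t` on `S₀` (used when `a_ℓ(g)` is odd). [cite: DiamondShurman2005, Prop. 5.2.2 (a), §5.7, Prop. 5.8.5] -/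
theorem heckeT_fiber_sq_three (ℓ : ℕ+) (hℓ : (ℓ : ℕ).Prime) (hℓN : (ℓ : ℕ) ∣ N) (hℓN₀ : ¬ (ℓ : ℕ) ∣ N₀)
    (S₀ : Finset ℕ+) (hS₀ : ∀ t ∈ S₀, ¬ (ℓ : ℕ) ∣ (t : ℕ)) (h : ∀ t ∈ S₀, N₀ * (t : ℕ) ∣ N)
    (h' : ∀ t ∈ S₀, N₀ * ((t * ℓ : ℕ+) : ℕ) ∣ N) (h'' : ∀ t ∈ S₀, N₀ * ((t * ℓ * ℓ : ℕ+) : ℕ) ∣ N) :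
    heckeT (Gamma0 N) 2 ℓ (∑ t ∈ S₀, degeneracyMap0 N₀ N (t : ℕ) 2 g + ∑ t ∈ S₀, degeneracyMap0 N₀ N ((t * ℓ : ℕ+) : ℕ) 2 g +
        ∑ t ∈ S₀, degeneracyMap0 N₀ N ((t * ℓ * ℓ : ℕ+) : ℕ) 2 g) =
      (cuspCoeff g ℓ + ℓ) • ∑ t ∈ S₀, degeneracyMap0 N₀ N (t : ℕ) 2 g +
        (((ℓ : ℕ) : ℂ) - 1) • ∑ t ∈ S₀, degeneracyMap0 N₀ N ((t * ℓ : ℕ+) : ℕ) 2 g := by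
  have h1 : ∀ t ∈ S₀, heckeT (Gamma0 N) 2 ℓ (degeneracyMap0 N₀ N (t : ℕ) 2 g) =
      cuspCoeff g ℓ • degeneracyMap0 N₀ N (t : ℕ) 2 g - degeneracyMap0 N₀ N ((t * ℓ : ℕ+) : ℕ) 2 g := fun t ht ↦
    heckeT_D_of_not_dvd (N := N) hg hℓ hℓN hℓN₀ (hS₀ t ht) (PNat.mul_coe t ℓ) (h t ht) (h' t ht)
  have h2 : ∀ t ∈ S₀, heckeT (Gamma0 N) 2 ℓ (degeneracyMap0 N₀ N ((t * ℓ : ℕ+) : ℕ) 2 g) =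
      ((ℓ : ℕ) : ℂ) • degeneracyMap0 N₀ N (t : ℕ) 2 g := fun t ht ↦
    heckeT_D_of_dvd (N := N) g hℓ hℓN (PNat.mul_coe t ℓ) (h t ht) (h' t ht)
  have h3 : ∀ t ∈ S₀, heckeT (Gamma0 N) 2 ℓ (degeneracyMap0 N₀ N ((t * ℓ * ℓ : ℕ+) : ℕ) 2 g) =
      ((ℓ : ℕ) : ℂ) • degeneracyMap0 N₀ N ((t * ℓ : ℕ+) : ℕ) 2 g := fun t ht ↦
    heckeT_D_of_dvd (N := N) g hℓ hℓN (PNat.mul_coe (t * ℓ) ℓ) (h' t ht) (h'' t ht)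
  rw [map_add, map_add, map_sum, map_sum, map_sum, Finset.sum_congr rfl h1, Finset.sum_congr rfl h2,
    Finset.sum_congr rfl h3, Finset.sum_sub_distrib, ← Finset.smul_sum, ← Finset.smul_sum, ← Finset.smul_sum, add_smul,
    sub_smul, one_smul]
  abel

include hg in
/-- **Inert fibre** (`p ∣ N₀`, `p ∤ t` on `S`): `T_p H_S = a_p(g) • H_S`. [cite: DiamondShurman2005, Prop. 5.2.2 (a), §5.7] -/
theorem heckeT_oldSum_of_dvd_level_of_coprime {p : ℕ} (hp : p.Prime) (hpN₀ : p ∣ N₀) (S : Finset ℕ+)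
    (hS : ∀ t ∈ S, ¬ p ∣ (t : ℕ)) (h : ∀ t ∈ S, N₀ * (t : ℕ) ∣ N) :
    (haveI : NeZero p := ⟨hp.ne_zero⟩; heckeT (Gamma0 N) 2 p (∑ t ∈ S, degeneracyMap0 N₀ N (t : ℕ) 2 g)) =
      cuspCoeff g p • ∑ t ∈ S, degeneracyMap0 N₀ N (t : ℕ) 2 g := by
  haveI : NeZero p := ⟨hp.ne_zero⟩
  rw [map_sum, Finset.smul_sum]
  exact Finset.sum_congr rfl fun t ht ↦ heckeT_D_of_dvd_level (N := N) hg hp hpN₀ (hS t ht) (h t ht)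

end Fibers

end MultOneDictionary

end Summit.BirchSwinnertonDyer.BirchSwinnertonDyer.Theorems.SignedMuAtTwo

end
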